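/-
Copyright (c) 2026 the pub-hodgecm-mathlib formalisation cell (harness21).  Prover seat hodgecm-mathlib-R90-CS-p03 (g2), R90-TF section S8 «ContSpec-n½» (dealer R90-CS-plan (g3),
S8-R144 (β″), census `R90/S8/CENSUS-hA32-arch.R90-CS-p03-g2.md` brick (4a); file (a-5)): the ARCHIMEDEAN half of ★ F5's `hA32` in its POSITIVITY form — a real non-negative archimedean weight
not a.e. zero has a strictly positive archimedean χ-factor at every real `σ > 1` — and the assembled `A(3∕2) ≠ 0` for that weight class with test weights at the bad places.
-/
import Summits.HodgeConjecture.HodgeConjecture.Theorems.K2E1ChiLocalMeanTestWeightU3   -- ★ (a-4) (this seat): test weights; brings ★ (a-3) (`integral_integral_archWeight_mul_arch_cpow_neg_eq`, `continuous_arch`), ★ arch integrability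
import HarnessLib

/-!
# K2·E1 ∕ R90·S8 — `K2E1ChiArchFactorPositivityU3` (file (a-5)): POSITIVITY OF THE ARCHIMEDEAN χ-FACTOR FOR REAL NON-NEGATIVE WEIGHTS, AND `A(3∕2) ≠ 0` FOR THAT CORNER —
# `0 < ∫ r·ARCH₃^{−σ} d(μ_{E,∞}⊗μ_{F,∞})` (`σ > 1`, `0 ≤ r ≤ 1` not a.e. `0`), hence ★ (a-2b)'s amplitude `A(3∕2) = C·(∫∫ r·ARCH₃^{−3∕2})·∏_{v∈S₀} m_v(3∕2) ≠ 0` with ★ (a-4)'s test weights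

Cell `pub/hodgecm-mathlib`, crux h413 = `stmt-HodgeConjecture-24833`, route of record `HCCMUnconditional`; R90-TF section S8 «ContSpec-n½», road R2-χ₃ (the (V) scalar road; ★ F5's binder
`hA32 : A (3∕2) ≠ 0`).  THEOREMS ONLY (no `def`, no `instance`, no notation, no named-fact hypothesis, no `sorry`; default heartbeats); lane `--supports stmt-HodgeConjecture-24833 --as helper`
(count-neutral).  Closes no socket.

HONEST CORNER (census (β″) (3)–(4), dealer S8-R144): for the archimedean weight OF RECORD — a `T∩K_∞`-phase × a 1-dim `K_∞`-type `det^a ⊗ u^b` — the archimedean factor at `z = 3∕2` is a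
Beta∕Γ value `∝ ∏_w 1∕(Γ(3∕2 + m_w∕2)Γ(3∕2 − m_w∕2))`, non-zero iff every `m_w ∉ ±{3,5,7,…}`; THAT evaluation (brick (4b)) is NOT here.  THIS file is the corner `m_w = 0 ∀ w` (trivial
`K_∞`-data: `χ_∞|_{T∩K} = 1`, τ = 1), i.e. REAL NON-NEGATIVE weights, where non-vanishing is POSITIVITY and needs no evaluation.
THE MATHEMATICS ([MoeglinWaldspurger1995] II.1.7, IV.1.11; [Langlands1976] Appendix).  `ARCH₃ ≥ 1` (★ `one_le_arch`), `ARCH₃^{−σ} ∈ L¹(μ_{E,∞}⊗μ_{F,∞})` for `σ > 1` (★ `integrable_arch_rpow_neg_prod_real`);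
for `0 ≤ r ≤ 1` a.e.-measurable with `r ≥ c > 0` on a set `S` of positive measure, `r·ARCH₃^{−σ} ≥ 0` is integrable with support `⊇ S`, so its integral is `> 0` (Mathlib
`integral_pos_iff_support_of_nonneg_ae`); cast to `ℂ` and to the ITERATED form of ★ (a-2b)∕(a-3) by ★ `integral_integral_archWeight_mul_arch_cpow_neg_eq` + `Complex.ofReal_cpow`.
* §1 **`integral_realWeight_mul_arch_rpow_neg_pos`** (`0 < ∫ r·ARCH₃^{−σ} d(μ_{E,∞}⊗μ_{F,∞})`), `measure_univ_prod_pos` + **`integral_arch_rpow_neg_pos`** (`r = 1`).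
* §2 **`integral_integral_realWeight_mul_arch_cpow_neg_ne_zero`** — `∫ Xi, ∫ a, (r Xi a : ℂ)·ARCH₃(Xi,a)^{−(σ:ℂ)} ≠ 0` (real `σ > 1`; ★ (a-3)'s iterated shape), and **`…_threeHalves`** at `z = 3∕2`.
* §3 HEAD **`chiAmplitude_threeHalves_ne_zero_of_realWeight_of_testWeights`** — ★ F5's `hA32` for ★ (a-3)'s amplitude `fun z => C·(∫ Xi, ∫ a, ωinf Xi a·ARCH₃^{−z})·∏_{v∈S₀} m_v(z)` at
  `ωinf := (r : ℂ)` (this corner) and ★ (a-4) test weights at every `v ∈ S₀`, `C ≠ 0`.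
HONEST LABEL: HC_CM is proved only modulo the 7 printed citations (2 remaining named inputs: hLiu418 = `stmt-HodgeConjecture-24832`, h413 = `stmt-HodgeConjecture-24833`) until rung 0
closes; REL ≠ ★ ≠ BUILT; this file asserts no named fact and closes no socket; count-neutral; the weight class is a CORNER of the case of record (see above), said plainly.

## References
* [MoeglinWaldspurger1995] C. Mœglin, J.-L. Waldspurger, *Spectral Decomposition and Eisenstein Series* (1995): II.1.7, IV.1.11.
* [Langlands1976] R. P. Langlands, *On the Functional Equations Satisfied by Eisenstein Series*, LNM 544 (1976): Appendix (rank one).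
* [Titchmarsh1939] E. C. Titchmarsh, *The Theory of Functions*, 2nd ed. (1939): §2.8.
-/

set_option autoImplicit false
set_option linter.dupNamespace false -- the mandated namespace repeats `HodgeConjecture.HodgeConjecture`

noncomputable section

open MeasureTheory MeasureTheory.Measure NumberField NumberField.InfinitePlace IsDedekindDomain Filter Set
open scoped NNReal ENNReal
open Literature.NumberTheory.Automorphic Literature.NumberTheory.Automorphic.UnitaryGroup Literature.NumberTheory.GaloisRepresentations
open Literature.NumberTheory.GaloisRepresentations.IsNonarchimedeanLocalField
open Summit.HodgeConjecture.HodgeConjecture.Cruxes.H413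
open Summit.HodgeConjecture.HodgeConjecture.Cruxes.H413.K2E1IntertwiningArchFactorIntegrableU3 (one_le_arch integrable_arch_rpow_neg_prod_real)
open Summit.HodgeConjecture.HodgeConjecture.Cruxes.H413.K2E1ChiIntertwiningLocalFactorHolomorphicU3 (continuous_arch integral_integral_archWeight_mul_arch_cpow_neg_eq)
open Summit.HodgeConjecture.HodgeConjecture.Cruxes.H413.K2E1ChiLocalMeanTestWeightU3 (chiLocalMean_ne_zero_of_testWeight)

namespace Summit.HodgeConjecture.HodgeConjecture.Cruxes.H413.K2E1ChiArchFactorPositivityU3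

variable (L : Type) [Field L] [NumberField L] [IsCMField L] {δ : L} (hcδ : IsCMField.complexConj L δ = -δ) (hδ : δ ≠ 0)
  {d : ↥(maximalRealSubfield L)} (hd : δ * δ = algebraMap ↥(maximalRealSubfield L) L d)

section Arch

variable [MeasurableSpace (InfiniteAdeleRing L)] [BorelSpace (InfiniteAdeleRing L)]
  [MeasurableSpace (InfiniteAdeleRing ↥(maximalRealSubfield L))] [BorelSpace (InfiniteAdeleRing ↥(maximalRealSubfield L))]
  (μE₁ : Measure (InfiniteAdeleRing L)) [μE₁.IsAddHaarMeasure] (μF₁ : Measure (InfiniteAdeleRing ↥(maximalRealSubfield L))) [μF₁.IsAddHaarMeasure]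

/-! ## §1 Positivity of the real-weighted archimedean factor -/

include hδ in
/-- **`0 < ∫ r·ARCH₃^{−σ} d(μ_{E,∞}⊗μ_{F,∞})` for every REAL `σ > 1`** when the real weight `r` is a.e.-strongly-measurable with `0 ≤ r ≤ 1` and `r ≥ c > 0` on a set `S` of positive
measure (integrand `≥ 0`, integrable by domination ★, support `⊇ S`). [cite: MoeglinWaldspurger1995, II.1.7] [cite: Langlands1976, Appendix] -/
theorem integral_realWeight_mul_arch_rpow_neg_pos (r : InfiniteAdeleRing L → InfiniteAdeleRing ↥(maximalRealSubfield L) → ℝ)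
    (hr : AEStronglyMeasurable (fun p : InfiniteAdeleRing L × InfiniteAdeleRing ↥(maximalRealSubfield L) => r p.1 p.2) (μE₁.prod μF₁)) (hr0 : ∀ Xi a, 0 ≤ r Xi a) (hr1 : ∀ Xi a, r Xi a ≤ 1)
    {S : Set (InfiniteAdeleRing L × InfiniteAdeleRing ↥(maximalRealSubfield L))} (hS : 0 < (μE₁.prod μF₁) S) {c : ℝ} (hc : 0 < c) (hrS : ∀ p ∈ S, c ≤ r p.1 p.2) {σ : ℝ} (hσ : 1 < σ) :
    0 < ∫ p : InfiniteAdeleRing L × InfiniteAdeleRing ↥(maximalRealSubfield L), r p.1 p.2 * (∏ w : InfinitePlace L, ((1 + ‖(p.1) w‖ ^ 2 / 2) ^ 2 + (w δ) ^ 2 * (((InfiniteAdeleRing.ringEquiv_mixedSpace ↥(maximalRealSubfield L)) p.2).1 ⟨w.comap (algebraMap ↥(maximalRealSubfield L) L), K2E1HeightBigCellLineFormulaU2.isReal_comap_maximalRealSubfield L w⟩) ^ 2)) ^ (-σ) ∂(μE₁.prod μF₁) := by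
  haveI : SecondCountableTopology (InfiniteAdeleRing L) := secondCountableTopology_infiniteAdeleRing L
  haveI : SecondCountableTopology (InfiniteAdeleRing ↥(maximalRealSubfield L)) := secondCountableTopology_infiniteAdeleRing _
  have hApos : ∀ p : InfiniteAdeleRing L × InfiniteAdeleRing ↥(maximalRealSubfield L), 0 < (∏ w : InfinitePlace L, ((1 + ‖(p.1) w‖ ^ 2 / 2) ^ 2 + (w δ) ^ 2 * (((InfiniteAdeleRing.ringEquiv_mixedSpace ↥(maximalRealSubfield L)) p.2).1 ⟨w.comap (algebraMap ↥(maximalRealSubfield L) L), K2E1HeightBigCellLineFormulaU2.isReal_comap_maximalRealSubfield L w⟩) ^ 2)) ^ (-σ) :=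
    fun p => Real.rpow_pos_of_pos (lt_of_lt_of_le one_pos (one_le_arch L p.1 p.2)) _
  have hcont : Continuous fun p : InfiniteAdeleRing L × InfiniteAdeleRing ↥(maximalRealSubfield L) => (∏ w : InfinitePlace L, ((1 + ‖(p.1) w‖ ^ 2 / 2) ^ 2 + (w δ) ^ 2 * (((InfiniteAdeleRing.ringEquiv_mixedSpace ↥(maximalRealSubfield L)) p.2).1 ⟨w.comap (algebraMap ↥(maximalRealSubfield L) L), K2E1HeightBigCellLineFormulaU2.isReal_comap_maximalRealSubfield L w⟩) ^ 2)) ^ (-σ) :=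
    (continuous_arch L (δ := δ)).rpow_const fun p => Or.inl (lt_of_lt_of_le one_pos (one_le_arch L p.1 p.2)).ne'
  have hint : Integrable (fun p : InfiniteAdeleRing L × InfiniteAdeleRing ↥(maximalRealSubfield L) => r p.1 p.2 * (∏ w : InfinitePlace L, ((1 + ‖(p.1) w‖ ^ 2 / 2) ^ 2 + (w δ) ^ 2 * (((InfiniteAdeleRing.ringEquiv_mixedSpace ↥(maximalRealSubfield L)) p.2).1 ⟨w.comap (algebraMap ↥(maximalRealSubfield L) L), K2E1HeightBigCellLineFormulaU2.isReal_comap_maximalRealSubfield L w⟩) ^ 2)) ^ (-σ)) (μE₁.prod μF₁) := by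
    refine Integrable.mono' (integrable_arch_rpow_neg_prod_real L hδ μE₁ μF₁ hσ) (hr.mul hcont.aestronglyMeasurable) (Eventually.of_forall fun p => ?_)
    rw [Real.norm_eq_abs, abs_mul, abs_of_nonneg (hr0 p.1 p.2), abs_of_nonneg (hApos p).le]
    calc r p.1 p.2 * (∏ w : InfinitePlace L, ((1 + ‖(p.1) w‖ ^ 2 / 2) ^ 2 + (w δ) ^ 2 * (((InfiniteAdeleRing.ringEquiv_mixedSpace ↥(maximalRealSubfield L)) p.2).1 ⟨w.comap (algebraMap ↥(maximalRealSubfield L) L), K2E1HeightBigCellLineFormulaU2.isReal_comap_maximalRealSubfield L w⟩) ^ 2)) ^ (-σ)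
        ≤ 1 * (∏ w : InfinitePlace L, ((1 + ‖(p.1) w‖ ^ 2 / 2) ^ 2 + (w δ) ^ 2 * (((InfiniteAdeleRing.ringEquiv_mixedSpace ↥(maximalRealSubfield L)) p.2).1 ⟨w.comap (algebraMap ↥(maximalRealSubfield L) L), K2E1HeightBigCellLineFormulaU2.isReal_comap_maximalRealSubfield L w⟩) ^ 2)) ^ (-σ) := mul_le_mul_of_nonneg_right (hr1 p.1 p.2) (hApos p).le
      _ = _ := one_mul _
  rw [integral_pos_iff_support_of_nonneg_ae (Eventually.of_forall fun p => mul_nonneg (hr0 p.1 p.2) (hApos p).le) hint]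
  refine lt_of_lt_of_le hS (measure_mono fun p hp => ?_)
  exact Function.mem_support.2 (mul_ne_zero (lt_of_lt_of_le hc (hrS p hp)).ne' (hApos p).ne')

omit [IsCMField L] [BorelSpace (InfiniteAdeleRing L)] [BorelSpace (InfiniteAdeleRing ↥(maximalRealSubfield L))] in
/-- `(μ_{E,∞}⊗μ_{F,∞})(L_∞ × L⁺_∞) > 0` (both Haar measures charge the whole space). [folklore] -/
theorem measure_univ_prod_pos : 0 < (μE₁.prod μF₁) univ := by
  haveI : SecondCountableTopology (InfiniteAdeleRing L) := secondCountableTopology_infiniteAdeleRing L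
  haveI : SecondCountableTopology (InfiniteAdeleRing ↥(maximalRealSubfield L)) := secondCountableTopology_infiniteAdeleRing _
  rw [← univ_prod_univ, Measure.prod_prod]
  exact ENNReal.mul_pos (isOpen_univ.measure_pos μE₁ ⟨0, mem_univ _⟩).ne' (isOpen_univ.measure_pos μF₁ ⟨0, mem_univ _⟩).ne'

include hδ in
/-- **`0 < ∫ ARCH₃^{−σ} d(μ_{E,∞}⊗μ_{F,∞})` for every real `σ > 1`** — the spherical archimedean factor (`r = 1`, `S = univ`). [cite: MoeglinWaldspurger1995, II.1.7] -/
theorem integral_arch_rpow_neg_pos {σ : ℝ} (hσ : 1 < σ) :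
    0 < ∫ p : InfiniteAdeleRing L × InfiniteAdeleRing ↥(maximalRealSubfield L), (∏ w : InfinitePlace L, ((1 + ‖(p.1) w‖ ^ 2 / 2) ^ 2 + (w δ) ^ 2 * (((InfiniteAdeleRing.ringEquiv_mixedSpace ↥(maximalRealSubfield L)) p.2).1 ⟨w.comap (algebraMap ↥(maximalRealSubfield L) L), K2E1HeightBigCellLineFormulaU2.isReal_comap_maximalRealSubfield L w⟩) ^ 2)) ^ (-σ) ∂(μE₁.prod μF₁) := by
  have h := integral_realWeight_mul_arch_rpow_neg_pos L hδ μE₁ μF₁ (fun _ _ => (1 : ℝ)) aestronglyMeasurable_const (fun _ _ => zero_le_one) (fun _ _ => le_rfl)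
    (measure_univ_prod_pos L μE₁ μF₁) one_pos (fun _ _ => le_rfl) hσ
  simpa only [one_mul] using h

/-! ## §2 The iterated complex form of ★ (a-2b) ∕ (a-3), at real `σ > 1` and at `z = 3∕2` -/

include hδ in
/-- **`∫_{L_∞} ∫_{L⁺_∞} (r Ξ a : ℂ)·ARCH₃(Ξ,a)^{−(σ:ℂ)} dμ_{F,∞} dμ_{E,∞} ≠ 0`** for every real `σ > 1` under §1's hypotheses (iterated = product ★ (a-3); `(r:ℂ)·(A:ℂ)^{−σ} = ((r·A^{−σ} : ℝ) : ℂ)`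
`Complex.ofReal_cpow`; `integral_ofReal`; §1). [cite: MoeglinWaldspurger1995, II.1.7] -/
theorem integral_integral_realWeight_mul_arch_cpow_neg_ne_zero (r : InfiniteAdeleRing L → InfiniteAdeleRing ↥(maximalRealSubfield L) → ℝ)
    (hr : AEStronglyMeasurable (fun p : InfiniteAdeleRing L × InfiniteAdeleRing ↥(maximalRealSubfield L) => r p.1 p.2) (μE₁.prod μF₁)) (hr0 : ∀ Xi a, 0 ≤ r Xi a) (hr1 : ∀ Xi a, r Xi a ≤ 1)
    {S : Set (InfiniteAdeleRing L × InfiniteAdeleRing ↥(maximalRealSubfield L))} (hS : 0 < (μE₁.prod μF₁) S) {c : ℝ} (hc : 0 < c) (hrS : ∀ p ∈ S, c ≤ r p.1 p.2) {σ : ℝ} (hσ : 1 < σ) :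
    ∫ Xi : InfiniteAdeleRing L, ∫ a : InfiniteAdeleRing ↥(maximalRealSubfield L), ((r Xi a : ℝ) : ℂ) * ((((∏ w : InfinitePlace L, ((1 + ‖(Xi) w‖ ^ 2 / 2) ^ 2 + (w δ) ^ 2 * (((InfiniteAdeleRing.ringEquiv_mixedSpace ↥(maximalRealSubfield L)) a).1 ⟨w.comap (algebraMap ↥(maximalRealSubfield L) L), K2E1HeightBigCellLineFormulaU2.isReal_comap_maximalRealSubfield L w⟩) ^ 2))) : ℝ) : ℂ) ^ (-(σ : ℂ)) ∂μF₁ ∂μE₁ ≠ 0 := by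
  have hω : AEStronglyMeasurable (fun p : InfiniteAdeleRing L × InfiniteAdeleRing ↥(maximalRealSubfield L) => ((r p.1 p.2 : ℝ) : ℂ)) (μE₁.prod μF₁) := Complex.continuous_ofReal.comp_aestronglyMeasurable hr
  have hωb : ∀ Xi a, ‖((r Xi a : ℝ) : ℂ)‖ ≤ 1 := fun Xi a => by
    rw [Complex.norm_real, Real.norm_eq_abs, abs_of_nonneg (hr0 Xi a)]; exact hr1 Xi a
  have hz : 1 < (σ : ℂ).re := by rwa [Complex.ofReal_re]
  rw [integral_integral_archWeight_mul_arch_cpow_neg_eq L hδ μE₁ μF₁ (fun Xi a => ((r Xi a : ℝ) : ℂ)) hω hωb hz]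
  have hpt : ∀ p : InfiniteAdeleRing L × InfiniteAdeleRing ↥(maximalRealSubfield L), ((r p.1 p.2 : ℝ) : ℂ) * ((((∏ w : InfinitePlace L, ((1 + ‖(p.1) w‖ ^ 2 / 2) ^ 2 + (w δ) ^ 2 * (((InfiniteAdeleRing.ringEquiv_mixedSpace ↥(maximalRealSubfield L)) p.2).1 ⟨w.comap (algebraMap ↥(maximalRealSubfield L) L), K2E1HeightBigCellLineFormulaU2.isReal_comap_maximalRealSubfield L w⟩) ^ 2))) : ℝ) : ℂ) ^ (-(σ : ℂ)) =
      ((r p.1 p.2 * (∏ w : InfinitePlace L, ((1 + ‖(p.1) w‖ ^ 2 / 2) ^ 2 + (w δ) ^ 2 * (((InfiniteAdeleRing.ringEquiv_mixedSpace ↥(maximalRealSubfield L)) p.2).1 ⟨w.comap (algebraMap ↥(maximalRealSubfield L) L), K2E1HeightBigCellLineFormulaU2.isReal_comap_maximalRealSubfield L w⟩) ^ 2)) ^ (-σ) : ℝ) : ℂ) := fun p => by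
    rw [Complex.ofReal_mul, ← Complex.ofReal_neg, ← Complex.ofReal_cpow (le_trans zero_le_one (one_le_arch L p.1 p.2))]
  rw [integral_congr_ae (Eventually.of_forall hpt)]
  intro h
  have h' := (integral_ofReal (𝕜 := ℂ) (μ := μE₁.prod μF₁)
    (f := fun p : InfiniteAdeleRing L × InfiniteAdeleRing ↥(maximalRealSubfield L) => r p.1 p.2 * (∏ w : InfinitePlace L, ((1 + ‖(p.1) w‖ ^ 2 / 2) ^ 2 + (w δ) ^ 2 * (((InfiniteAdeleRing.ringEquiv_mixedSpace ↥(maximalRealSubfield L)) p.2).1 ⟨w.comap (algebraMap ↥(maximalRealSubfield L) L), K2E1HeightBigCellLineFormulaU2.isReal_comap_maximalRealSubfield L w⟩) ^ 2)) ^ (-σ))).symm.trans h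
  exact (integral_realWeight_mul_arch_rpow_neg_pos L hδ μE₁ μF₁ r hr hr0 hr1 hS hc hrS hσ).ne' (Complex.ofReal_eq_zero.1 h')

include hδ in
/-- **AT `z = 3∕2`**: `∫ Ξ, ∫ a, (r Ξ a : ℂ)·ARCH₃(Ξ,a)^{−(3∕2)} ≠ 0` (§2 at `σ = 3∕2`, `((3∕2 : ℝ) : ℂ) = 3∕2`). [cite: MoeglinWaldspurger1995, IV.1.11] -/
theorem integral_integral_realWeight_mul_arch_cpow_neg_ne_zero_threeHalves (r : InfiniteAdeleRing L → InfiniteAdeleRing ↥(maximalRealSubfield L) → ℝ)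
    (hr : AEStronglyMeasurable (fun p : InfiniteAdeleRing L × InfiniteAdeleRing ↥(maximalRealSubfield L) => r p.1 p.2) (μE₁.prod μF₁)) (hr0 : ∀ Xi a, 0 ≤ r Xi a) (hr1 : ∀ Xi a, r Xi a ≤ 1)
    {S : Set (InfiniteAdeleRing L × InfiniteAdeleRing ↥(maximalRealSubfield L))} (hS : 0 < (μE₁.prod μF₁) S) {c : ℝ} (hc : 0 < c) (hrS : ∀ p ∈ S, c ≤ r p.1 p.2) :
    ∫ Xi : InfiniteAdeleRing L, ∫ a : InfiniteAdeleRing ↥(maximalRealSubfield L), ((r Xi a : ℝ) : ℂ) * ((((∏ w : InfinitePlace L, ((1 + ‖(Xi) w‖ ^ 2 / 2) ^ 2 + (w δ) ^ 2 * (((InfiniteAdeleRing.ringEquiv_mixedSpace ↥(maximalRealSubfield L)) a).1 ⟨w.comap (algebraMap ↥(maximalRealSubfield L) L), K2E1HeightBigCellLineFormulaU2.isReal_comap_maximalRealSubfield L w⟩) ^ 2))) : ℝ) : ℂ) ^ (-(3 / 2 : ℂ)) ∂μF₁ ∂μE₁ ≠ 0 := by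
  have h := integral_integral_realWeight_mul_arch_cpow_neg_ne_zero L hδ μE₁ μF₁ r hr hr0 hr1 hS hc hrS (σ := 3 / 2) (by norm_num)
  have h32 : ((3 / 2 : ℝ) : ℂ) = 3 / 2 := by push_cast; ring
  rwa [h32] at h

end Arch

/-! ## §3 HEAD: `A(3∕2) ≠ 0` for the real-weight corner at ∞ and test weights at the bad places -/

section Amplitude

variable [MeasurableSpace (InfiniteAdeleRing L)] [BorelSpace (InfiniteAdeleRing L)]
  [MeasurableSpace (InfiniteAdeleRing ↥(maximalRealSubfield L))] [BorelSpace (InfiniteAdeleRing ↥(maximalRealSubfield L))]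
  (μE₁ : Measure (InfiniteAdeleRing L)) [μE₁.IsAddHaarMeasure] (μF₁ : Measure (InfiniteAdeleRing ↥(maximalRealSubfield L))) [μF₁.IsAddHaarMeasure]
  [∀ v : HeightOneSpectrum (𝓞 ↥(maximalRealSubfield L)), MeasurableSpace (v.adicCompletion ↥(maximalRealSubfield L))] [∀ v : HeightOneSpectrum (𝓞 ↥(maximalRealSubfield L)), BorelSpace (v.adicCompletion ↥(maximalRealSubfield L))]
  (νv : ∀ v : HeightOneSpectrum (𝓞 ↥(maximalRealSubfield L)), Measure (v.adicCompletion ↥(maximalRealSubfield L))) [∀ v, (νv v).IsAddHaarMeasure]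

omit [∀ v : HeightOneSpectrum (𝓞 ↥(maximalRealSubfield L)), BorelSpace (v.adicCompletion ↥(maximalRealSubfield L))] in
include hδ in
/-- **★ F5's `hA32` IN THE REAL-WEIGHT CORNER: `A(3∕2) = C·(∫_{L_∞}∫_{L⁺_∞} (r:ℂ)·ARCH₃^{−3∕2})·∏_{v∈S₀} m_v(3∕2) ≠ 0`** — for `C ≠ 0`, an archimedean weight `ωinf = (r : ℂ)` with `0 ≤ r ≤ 1`
a.e.-measurable and `≥ c > 0` on a set of positive measure (§2), and at every `v ∈ S₀` a ★ (a-4) test weight (`= c_v ≠ 0` on a measurable `B_v` of positive finite volume with `Q_v = 1`,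
`= 0` off it).  This is `A (3∕2) ≠ 0` for the `A` of ★ (a-3) `differentiableOn_chiAmplitude_three` at `ωinf := fun Ξ a => (r Ξ a : ℂ)`. [cite: MoeglinWaldspurger1995, IV.1.11]
[cite: Rogawski1990, §13.9 p. 229] -/
theorem chiAmplitude_threeHalves_ne_zero_of_realWeight_of_testWeights {C : ℂ} (hC : C ≠ 0) (S₀ : Finset (HeightOneSpectrum (𝓞 ↥(maximalRealSubfield L))))
    (ω : ∀ v : HeightOneSpectrum (𝓞 ↥(maximalRealSubfield L)), (Fin 3 → v.adicCompletion ↥(maximalRealSubfield L)) → ℂ)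
    (B : ∀ v : HeightOneSpectrum (𝓞 ↥(maximalRealSubfield L)), Set (Fin 3 → v.adicCompletion ↥(maximalRealSubfield L))) (cv : HeightOneSpectrum (𝓞 ↥(maximalRealSubfield L)) → ℂ)
    (hBm : ∀ v ∈ S₀, MeasurableSet (B v)) (hBpos : ∀ v ∈ S₀, 0 < (Measure.pi fun _ : Fin 3 => νv v) (B v)) (hBfin : ∀ v ∈ S₀, (Measure.pi fun _ : Fin 3 => νv v) (B v) < ⊤)
    (hQ : ∀ v ∈ S₀, ∀ p ∈ B v, (∏ w' : PlacesOver L v, max 1 (max ((normAbs (w'.1.adicCompletion L) (quadraticLocalEquiv L v (IsCMField.complexConj L) hcδ hδ (p 0, p 1) w') : ℝ≥0) : ℝ)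
            ((normAbs (w'.1.adicCompletion L) ((toLocalRing L v (p 2) * algebraMap L (LocalRing L v) δ -
              toLocalRing L v 2⁻¹ * (quadraticLocalEquiv L v (IsCMField.complexConj L) hcδ hδ (p 0, p 1) *
                conjLocal L (IsCMField.complexConj L) v (quadraticLocalEquiv L v (IsCMField.complexConj L) hcδ hδ (p 0, p 1)))) w') : ℝ≥0) : ℝ))) = 1)
    (hcv : ∀ v ∈ S₀, cv v ≠ 0) (hωB : ∀ v ∈ S₀, ∀ p ∈ B v, ω v p = cv v) (hω0 : ∀ v ∈ S₀, ∀ p ∉ B v, ω v p = 0)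
    (r : InfiniteAdeleRing L → InfiniteAdeleRing ↥(maximalRealSubfield L) → ℝ)
    (hr : AEStronglyMeasurable (fun p : InfiniteAdeleRing L × InfiniteAdeleRing ↥(maximalRealSubfield L) => r p.1 p.2) (μE₁.prod μF₁)) (hr0 : ∀ Xi a, 0 ≤ r Xi a) (hr1 : ∀ Xi a, r Xi a ≤ 1)
    {S : Set (InfiniteAdeleRing L × InfiniteAdeleRing ↥(maximalRealSubfield L))} (hS : 0 < (μE₁.prod μF₁) S) {c : ℝ} (hc : 0 < c) (hrS : ∀ p ∈ S, c ≤ r p.1 p.2) :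
    C * (∫ Xi : InfiniteAdeleRing L, ∫ a : InfiniteAdeleRing ↥(maximalRealSubfield L),
        ((r Xi a : ℝ) : ℂ) * ((((∏ w : InfinitePlace L, ((1 + ‖(Xi) w‖ ^ 2 / 2) ^ 2 + (w δ) ^ 2 * (((InfiniteAdeleRing.ringEquiv_mixedSpace ↥(maximalRealSubfield L)) a).1 ⟨w.comap (algebraMap ↥(maximalRealSubfield L) L), K2E1HeightBigCellLineFormulaU2.isReal_comap_maximalRealSubfield L w⟩) ^ 2))) : ℝ) : ℂ) ^ (-(3 / 2 : ℂ)) ∂μF₁ ∂μE₁) *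
      ∏ v ∈ S₀, ((Measure.pi fun _ : Fin 3 => νv v) (integralBox ↥(maximalRealSubfield L) (Fin 3) v)).toReal⁻¹ •
        ∫ p : Fin 3 → v.adicCompletion ↥(maximalRealSubfield L),
          ω v p * ((((∏ w' : PlacesOver L v, max 1 (max ((normAbs (w'.1.adicCompletion L) (quadraticLocalEquiv L v (IsCMField.complexConj L) hcδ hδ (p 0, p 1) w') : ℝ≥0) : ℝ)
            ((normAbs (w'.1.adicCompletion L) ((toLocalRing L v (p 2) * algebraMap L (LocalRing L v) δ -
              toLocalRing L v 2⁻¹ * (quadraticLocalEquiv L v (IsCMField.complexConj L) hcδ hδ (p 0, p 1) *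
                conjLocal L (IsCMField.complexConj L) v (quadraticLocalEquiv L v (IsCMField.complexConj L) hcδ hδ (p 0, p 1)))) w') : ℝ≥0) : ℝ)))) : ℝ) : ℂ) ^ (-(3 / 2 : ℂ)) ∂(Measure.pi fun _ : Fin 3 => νv v) ≠ 0 := by
  refine mul_ne_zero (mul_ne_zero hC (integral_integral_realWeight_mul_arch_cpow_neg_ne_zero_threeHalves L hδ μE₁ μF₁ r hr hr0 hr1 hS hc hrS)) ?_
  exact Finset.prod_ne_zero_iff.2 fun v hv =>
    chiLocalMean_ne_zero_of_testWeight L hcδ hδ v (νv v) (hBm v hv) (hBpos v hv) (hBfin v hv) (hQ v hv) (hcv v hv) (ω v) (hωB v hv) (hω0 v hv) _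

end Amplitude

end Summit.HodgeConjecture.HodgeConjecture.Cruxes.H413.K2E1ChiArchFactorPositivityU3

end
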